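import Summits.BirchSwinnertonDyer.BirchSwinnertonDyer.Theorems.PrintCf2SplitBadRubinValueTwoAnchorsOfPrint
import Summits.BirchSwinnertonDyer.BirchSwinnertonDyer.Theorems.PrintCf2SplitBadTwoUpperHalfOfFactsRubinRoad
import Summits.BirchSwinnertonDyer.BirchSwinnertonDyer.Theorems.PrintCf2SplitBadTwoDefectKeyAtTwo
import HarnessLib

set_option linter.dupNamespace false
set_option autoImplicit false

/-!
# Crux `PrintCf2.SplitBadTwoRankOneOfFacts` (stmt-BirchSwinnertonDyer-20368), road α (parent skeleton of record v7 17410fff91d3af18, LEAD g9):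
# **the composition WITHOUT A KIT ANCHOR** — crux ⟸ S0′ ∧ S2′ ∧ S3-law ∧ nine further prints, and crux ⟸ (DK) ∧ prints

Cell `bsd-print-cf2`, width seat `bsd-line-cf2-p1-w3` g4 (`--supports stmt-BirchSwinnertonDyer-20368`). THEOREMS ONLY; every published input
is an explicit binder; no `sorry`. HONEST FRAMING: compositions of landed theorems; the research stubs S2′ (`stub_rubinValueFormula_two`, v7 text) and the
S3 LAW (v5's `stub_ellipticUnitControl_two` body = the conclusion of v7's S3b `stub_ellipticUnitDescent_two` fed by S3a `stub_twoVariableMC_two`)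
— resp. LEAD g9's road-neutral defect-key statement (DK) — stay HYPOTHESES, displayed verbatim; nothing about BSD is asserted; BSD is not
proved by any of this; no summit statement is proved by this seat.

WHAT. The v5–v7 composition `SplitBadTwoRankOneOfFacts_of` (= -w3 g2's p637992 `RubinValueTwo.splitBadTwoRankOneOfFacts_of_laws (h0 h2 h3 h4)`)
feeds the crux from S0′ (five prints), S2′, the S3 law and the anchors S4b (v5/v6 `stub_anchor_two_kit` [computation/kit]; v7 S4b′
`stub_anchor_two_ofPrint`, facts-relative, LANDED p646096). The sibling file `…RubinValueTwoAnchorsOfPrint`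
(`RubinValueTwoAnchor.stub_anchor_two_kit_of_thirteen`) supplies the anchors BY NAME from cell bsd-goldfeld's decided prime-twist families modulo
thirteen print binders, of which `hS31`, `hnew` are already in S0′ and `hGZK`, `hBF` in the crux's own bundle `𝔅_split`. Hence:

* §1 `splitBadTwoRankOneOfFacts_of_laws_of_prints` — **S0′ ∧ S2′ ∧ S3-law ∧ {hCST, h12, h44, h14, hGZ, hKo, hM, hEta, hD} ⟹ the crux BY
  NAME** (S0′, S2′ in their REGISTERED v7 form, S2′'s facts-relative antecedents fed from S0′ and `𝔅_split` exactly as in the skeleton; the S3 law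
  = v5's S3 body = what v7's `stub_ellipticUnitDescent_two stub_twoVariableMC_two` delivers); the two children `SplitBadTwo{Upper,Lower}HalfOfFacts`
  (27850 / 27851) likewise (`…UpperHalf…`, `…LowerHalf…`). Road α's research content is S2′ ∧ S3 and nothing computational; S0″'s fifth
  conjunct (Burungale–Tian) is not needed.
* §2 `splitBadTwoRankOneOfFacts_of_defectKey_of_prints` — LEAD g9's socket (p644xxx `splitBadTwoRankOneOfFacts_of_defectKey`) with its
  anchor binder `h4` discharged the same way: **(DK) ∧ {hS31, hnew, GZ I.(7.3)} ∧ the nine prints ⟹ the crux BY NAME** — the class's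
  research content modulo prints is EXACTLY the defect-key statement (DK), no anchor, no kit.

References: [Miller2011LMS] Def. 1.1; [CoatesLiTianZhai2015] Thm. 1.2, 1.4, 4.4; [CaiShuTian2014] Thm. 1.1; [Rubin1992] Cor. 10.2–10.3 (shape);
[deShalit1987] II Thm. 4.14; [GrossZagier1986] I.(7.3).
-/

noncomputable section

open scoped Classical
open NumberField IsDedekindDomain Field WeierstrassCurve
open Literature.NumberTheory Literature.NumberTheory.GaloisRepresentations Literature.NumberTheory.EllipticCurves
open Literature.NumberTheory.EllipticCurves.ModularForms Literature.NumberTheory.EllipticCurves.CaiShuTian2014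
  Literature.NumberTheory.EllipticCurves.CoatesLiTianZhai2015
open Literature.NumberTheory.EllipticCurves.Rank1Residual
open Literature.NumberTheory.EllipticCurves.DeShalit1987
open Summit.BirchSwinnertonDyer.BirchSwinnertonDyer.Theses.PrintCf2
open Summit.BirchSwinnertonDyer.BirchSwinnertonDyer.Theorems
open Summit.BirchSwinnertonDyer.BirchSwinnertonDyer.Theorems.GoldfeldGoodTwists

namespace Summit.BirchSwinnertonDyer.BirchSwinnertonDyer.Theorems.PrintCf2.RubinValueTwoAnchor

/-! ## §1 Road α without a kit anchor: S0′ ∧ S2′ ∧ S3 ∧ nine prints ⟹ the crux and both children -/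

/-- **ROAD α WITHOUT A KIT ANCHOR — the crux BY NAME from S0′ ∧ S2′ ∧ S3 ∧ NINE PRINTS.** `h0` = S0′ = the registered cite stub
`stub_prints_rubin_two` (de Shalit II.4.14, Deuring, Creutz–Miller, Modularity, Gross–Zagier I.(7.3)); `h2` = S2′ = the registered research stub
`stub_rubinValueFormula_two` (facts-relative, v7 = v5 verbatim); `h3` = the S3 LAW (v5's `stub_ellipticUnitControl_two` body = the conclusion of v7's
`stub_ellipticUnitDescent_two`, i.e. `h3 := stub_ellipticUnitDescent_two stub_twoVariableMC_two` in the skeleton); the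
ten further binders `hCST h12 h44 h14 hGZ hKo hM hEta hD` are cell bsd-goldfeld's print binders that supply the anchors S4b by name
(`stub_anchor_two_kit_of_thirteen`; its `hS31`, `hnew` are `h0`'s, its `hGZK`, `hBF` are the first and fourth conjuncts of `𝔅_split`). Proof = the v7
composition `SplitBadTwoRankOneOfFacts_of` (one call of p637992 `RubinValueTwo.splitBadTwoRankOneOfFacts_of_laws`) with `h4` so discharged. CONDITIONAL on
the displayed binders. [cite: Rubin1992, Cor. 10.2 and Cor. 10.3 (shape)] [cite: Miller2011LMS, Def. 1.1] [cite: CoatesLiTianZhai2015, Thm. 1.2 (p. 359) and Thm. 1.4] -/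
theorem splitBadTwoRankOneOfFacts_of_laws_of_prints
    (h0 : DeShalit1987.thmII414_exists_katzBranch ∧ Deuring_exists_heckeCharacter_of_maximalCM ∧
      bsdTriple_of_rank_le_one_of_conductor_lt ∧ ModularForms.exists_isNewformOf ∧ GrossZagier1986_thm_I_7_3)
    (h2 : GrossZagier1986_thm_I_7_3 → rank_eq_analyticRank_of_analyticRank_le_one →
      ∃ eA : ℤ → ℤ → ℤ,
      ∀ (d : ℤ), d ≠ 0 → Squarefree d → d % 4 ≠ 1 →
      ∀ (W : WeierstrassCurve ℚ) [W.IsElliptic] [W.IsGloballyMinimal] (C : VariableChange ℚ),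
      C • W = cm7.quadraticTwist (d : ℚ) → W.analyticRank = 1 →
      ∀ (K : Type) [Field K] [NumberField K], IsImaginaryQuadratic K →
      ∀ (v vbar : HeightOneSpectrum (𝓞 K)),
      ((2 : ℕ) : 𝓞 K) ∈ v.asIdeal → ((2 : ℕ) : 𝓞 K) ∈ vbar.asIdeal → vbar ≠ v →
      ∀ (ι : PadicAlgCl 2 ≃+* ℂ),
      (∀ (w : InfinitePlace K) (k : 𝓞 K), k ∈ v.asIdeal ↔ ‖ι.symm (w.embedding (k : K))‖ < 1) →
      ∀ (c : K ≃ₐ[ℚ] K), c ≠ 1 →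
      ∀ (ψ : HeckeCharacter K), ψ.HasInfinityType (fun _ ↦ 1) (fun _ ↦ 0) →
      (∀ s : ℂ, 3 / 2 < s.re → heckeLFunction ψ s = W.LSeries s) →
      ∀ (S : Finset (HeightOneSpectrum (𝓞 K))),
      (∀ w : HeightOneSpectrum (𝓞 K), w ∈ S ↔ (¬ ψ.IsUnramifiedAt w ∧ w ≠ v ∧ w ≠ vbar)) →
      ∀ (κ : ZpExtension K 2) (γ : absoluteGaloisGroup K), κ.IsAnticyclotomic → κ.IsTopGenerator γ →
      ∀ (Ω δ : ℂ) (Ωp : (unrIntegers 2)ˣ) (G : PowerSeries (PadicComplexInt 2)),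
      Ω ≠ 0 → (δ ^ 2 = (NumberField.discr K : ℂ) ∨ δ ^ 2 = -(NumberField.discr K : ℂ)) →
      IsKatzBranch ι v vbar S κ γ (HeckeCharacter.galConj c ψ)⁻¹ Ω δ ((Ωp : unrIntegers 2) : ℂ_[2]) G →
      ∀ (P : W.toAffine.Point) (c₀ : ℕ) (ℓ : ℤ),
      ¬ IsOfFinAddOrder P →
      (∀ R : W.toAffine.Point, ∃ (k : ℤ) (T : W.toAffine.Point), IsOfFinAddOrder T ∧ R = k • P + T) →
      c₀ ≠ 0 → (W.baseChange ℚ_[2]).IsInReductionKernel (c₀ • W.toPadicPoint 2 P) →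
      ‖(W.baseChange ℚ_[2]).padicLogPoint (c₀ • W.toPadicPoint 2 P) / (c₀ : ℚ_[2])‖ = (2 : ℝ) ^ (-ℓ) →
      ∃ q : ℚ, shaAn W = (q : ℂ) ∧
      ∀ m : ℤ, ‖((PowerSeries.constantCoeff G : PadicComplexInt 2) : ℂ_[2])‖ = (2 : ℝ) ^ (-(m : ℝ) / 2) →
      m = 2 * (padicValRat 2 q + (padicValNat 2 W.tamagawaProduct : ℤ)
      - 2 * (padicValNat 2 W.torsionOrder : ℤ) + 2 * ℓ) + eA (d % 2) ((d / (2 - d % 2)) % 8))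
    (h3 : ∃ eB : ℤ → ℤ → ℤ,
      ∀ (d : ℤ), d ≠ 0 → Squarefree d → d % 4 ≠ 1 →
      ∀ (W : WeierstrassCurve ℚ) [W.IsElliptic] [W.IsGloballyMinimal] (C : VariableChange ℚ),
      C • W = cm7.quadraticTwist (d : ℚ) → W.analyticRank = 1 →
      ∀ (K : Type) [Field K] [NumberField K], IsImaginaryQuadratic K →
      ∀ (v vbar : HeightOneSpectrum (𝓞 K)),
      ((2 : ℕ) : 𝓞 K) ∈ v.asIdeal → ((2 : ℕ) : 𝓞 K) ∈ vbar.asIdeal → vbar ≠ v →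
      ∀ (ι : PadicAlgCl 2 ≃+* ℂ),
      (∀ (w : InfinitePlace K) (k : 𝓞 K), k ∈ v.asIdeal ↔ ‖ι.symm (w.embedding (k : K))‖ < 1) →
      ∀ (c : K ≃ₐ[ℚ] K), c ≠ 1 →
      ∀ (ψ : HeckeCharacter K), ψ.HasInfinityType (fun _ ↦ 1) (fun _ ↦ 0) →
      (∀ s : ℂ, 3 / 2 < s.re → heckeLFunction ψ s = W.LSeries s) →
      ∀ (S : Finset (HeightOneSpectrum (𝓞 K))),
      (∀ w : HeightOneSpectrum (𝓞 K), w ∈ S ↔ (¬ ψ.IsUnramifiedAt w ∧ w ≠ v ∧ w ≠ vbar)) →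
      ∀ (κ : ZpExtension K 2) (γ : absoluteGaloisGroup K), κ.IsAnticyclotomic → κ.IsTopGenerator γ →
      ∀ (Ω δ : ℂ) (Ωp : (unrIntegers 2)ˣ) (G : PowerSeries (PadicComplexInt 2)),
      Ω ≠ 0 → (δ ^ 2 = (NumberField.discr K : ℂ) ∨ δ ^ 2 = -(NumberField.discr K : ℂ)) →
      IsKatzBranch ι v vbar S κ γ (HeckeCharacter.galConj c ψ)⁻¹ Ω δ ((Ωp : unrIntegers 2) : ℂ_[2]) G →
      ∀ (P : W.toAffine.Point) (c₀ : ℕ) (ℓ : ℤ),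
      ¬ IsOfFinAddOrder P →
      (∀ R : W.toAffine.Point, ∃ (k : ℤ) (T : W.toAffine.Point), IsOfFinAddOrder T ∧ R = k • P + T) →
      c₀ ≠ 0 → (W.baseChange ℚ_[2]).IsInReductionKernel (c₀ • W.toPadicPoint 2 P) →
      ‖(W.baseChange ℚ_[2]).padicLogPoint (c₀ • W.toPadicPoint 2 P) / (c₀ : ℚ_[2])‖ = (2 : ℝ) ^ (-ℓ) →
      ∃ m : ℤ, ‖((PowerSeries.constantCoeff G : PadicComplexInt 2) : ℂ_[2])‖ = (2 : ℝ) ^ (-(m : ℝ) / 2) ∧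
      m = 2 * ((padicValNat 2 (Nat.card (AddCommGroup.primaryComponent W.sha 2)) : ℤ)
      + (padicValNat 2 W.tamagawaProduct : ℤ)
      - 2 * (padicValNat 2 W.torsionOrder : ℤ) + 2 * ℓ) + eB (d % 2) ((d / (2 - d % 2)) % 8))
    (hCST : thm11_ringClassChar) (h12 : thm12_fullBSD_twist) (h44 : thm44_ord_two_LAlg) (h14 : thm14_rankOne_twist)
    (hGZ : ∀ (N : ℕ) [NeZero N] (W : WeierstrassCurve ℚ) (K : Type) [Field K] [NumberField K], gross_zagier N W K)
    (hKo : ∀ (N : ℕ) [NeZero N] (W : WeierstrassCurve ℚ) (K : Type) [Field K] [NumberField K], kolyvagin N W K)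
    (hM : OptimalCurveManinCertificate cm7)
    (hEta : x049_x_sub_two_eq_etaQuotient) (hD : deuring_etaQuotient49_heegner_generates_conjPrime) :
    SplitBadTwoRankOneOfFacts := by
  intro hB W _ _ hCM hr hsplit hng
  exact PrintCf2.RubinValueTwo.splitBadTwoRankOneOfFacts_of_laws ⟨h0.1, h0.2.1, h0.2.2.1, h0.2.2.2.1⟩ (h2 h0.2.2.2.2 hB.1) h3
    (stub_anchor_two_kit_of_thirteen hCST h12 h44 h14 h0.2.2.1 h0.2.2.2.1 hM hB.2.2.2.1 hGZ hKo hB.1 hEta hD)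
    hB W hCM hr hsplit hng

/-- **The UPPER half (stmt-BirchSwinnertonDyer-27850) BY NAME from S0′ ∧ S2′ ∧ S3 ∧ nine prints** (p637992 `…UpperHalf…_of_laws` with the anchor
binder discharged by `stub_anchor_two_kit_of_thirteen`). CONDITIONAL on the displayed binders. [cite: Rubin1992, Cor. 10.3 (shape)] [cite: Miller2011LMS, Def. 1.1] -/
theorem splitBadTwoUpperHalfOfFacts_of_laws_of_prints
    (h0 : DeShalit1987.thmII414_exists_katzBranch ∧ Deuring_exists_heckeCharacter_of_maximalCM ∧
      bsdTriple_of_rank_le_one_of_conductor_lt ∧ ModularForms.exists_isNewformOf ∧ GrossZagier1986_thm_I_7_3)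
    (h2 : GrossZagier1986_thm_I_7_3 → rank_eq_analyticRank_of_analyticRank_le_one →
      ∃ eA : ℤ → ℤ → ℤ,
      ∀ (d : ℤ), d ≠ 0 → Squarefree d → d % 4 ≠ 1 →
      ∀ (W : WeierstrassCurve ℚ) [W.IsElliptic] [W.IsGloballyMinimal] (C : VariableChange ℚ),
      C • W = cm7.quadraticTwist (d : ℚ) → W.analyticRank = 1 →
      ∀ (K : Type) [Field K] [NumberField K], IsImaginaryQuadratic K →
      ∀ (v vbar : HeightOneSpectrum (𝓞 K)),
      ((2 : ℕ) : 𝓞 K) ∈ v.asIdeal → ((2 : ℕ) : 𝓞 K) ∈ vbar.asIdeal → vbar ≠ v →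
      ∀ (ι : PadicAlgCl 2 ≃+* ℂ),
      (∀ (w : InfinitePlace K) (k : 𝓞 K), k ∈ v.asIdeal ↔ ‖ι.symm (w.embedding (k : K))‖ < 1) →
      ∀ (c : K ≃ₐ[ℚ] K), c ≠ 1 →
      ∀ (ψ : HeckeCharacter K), ψ.HasInfinityType (fun _ ↦ 1) (fun _ ↦ 0) →
      (∀ s : ℂ, 3 / 2 < s.re → heckeLFunction ψ s = W.LSeries s) →
      ∀ (S : Finset (HeightOneSpectrum (𝓞 K))),
      (∀ w : HeightOneSpectrum (𝓞 K), w ∈ S ↔ (¬ ψ.IsUnramifiedAt w ∧ w ≠ v ∧ w ≠ vbar)) →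
      ∀ (κ : ZpExtension K 2) (γ : absoluteGaloisGroup K), κ.IsAnticyclotomic → κ.IsTopGenerator γ →
      ∀ (Ω δ : ℂ) (Ωp : (unrIntegers 2)ˣ) (G : PowerSeries (PadicComplexInt 2)),
      Ω ≠ 0 → (δ ^ 2 = (NumberField.discr K : ℂ) ∨ δ ^ 2 = -(NumberField.discr K : ℂ)) →
      IsKatzBranch ι v vbar S κ γ (HeckeCharacter.galConj c ψ)⁻¹ Ω δ ((Ωp : unrIntegers 2) : ℂ_[2]) G →
      ∀ (P : W.toAffine.Point) (c₀ : ℕ) (ℓ : ℤ),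
      ¬ IsOfFinAddOrder P →
      (∀ R : W.toAffine.Point, ∃ (k : ℤ) (T : W.toAffine.Point), IsOfFinAddOrder T ∧ R = k • P + T) →
      c₀ ≠ 0 → (W.baseChange ℚ_[2]).IsInReductionKernel (c₀ • W.toPadicPoint 2 P) →
      ‖(W.baseChange ℚ_[2]).padicLogPoint (c₀ • W.toPadicPoint 2 P) / (c₀ : ℚ_[2])‖ = (2 : ℝ) ^ (-ℓ) →
      ∃ q : ℚ, shaAn W = (q : ℂ) ∧
      ∀ m : ℤ, ‖((PowerSeries.constantCoeff G : PadicComplexInt 2) : ℂ_[2])‖ = (2 : ℝ) ^ (-(m : ℝ) / 2) →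
      m = 2 * (padicValRat 2 q + (padicValNat 2 W.tamagawaProduct : ℤ)
      - 2 * (padicValNat 2 W.torsionOrder : ℤ) + 2 * ℓ) + eA (d % 2) ((d / (2 - d % 2)) % 8))
    (h3 : ∃ eB : ℤ → ℤ → ℤ,
      ∀ (d : ℤ), d ≠ 0 → Squarefree d → d % 4 ≠ 1 →
      ∀ (W : WeierstrassCurve ℚ) [W.IsElliptic] [W.IsGloballyMinimal] (C : VariableChange ℚ),
      C • W = cm7.quadraticTwist (d : ℚ) → W.analyticRank = 1 →
      ∀ (K : Type) [Field K] [NumberField K], IsImaginaryQuadratic K →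
      ∀ (v vbar : HeightOneSpectrum (𝓞 K)),
      ((2 : ℕ) : 𝓞 K) ∈ v.asIdeal → ((2 : ℕ) : 𝓞 K) ∈ vbar.asIdeal → vbar ≠ v →
      ∀ (ι : PadicAlgCl 2 ≃+* ℂ),
      (∀ (w : InfinitePlace K) (k : 𝓞 K), k ∈ v.asIdeal ↔ ‖ι.symm (w.embedding (k : K))‖ < 1) →
      ∀ (c : K ≃ₐ[ℚ] K), c ≠ 1 →
      ∀ (ψ : HeckeCharacter K), ψ.HasInfinityType (fun _ ↦ 1) (fun _ ↦ 0) →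
      (∀ s : ℂ, 3 / 2 < s.re → heckeLFunction ψ s = W.LSeries s) →
      ∀ (S : Finset (HeightOneSpectrum (𝓞 K))),
      (∀ w : HeightOneSpectrum (𝓞 K), w ∈ S ↔ (¬ ψ.IsUnramifiedAt w ∧ w ≠ v ∧ w ≠ vbar)) →
      ∀ (κ : ZpExtension K 2) (γ : absoluteGaloisGroup K), κ.IsAnticyclotomic → κ.IsTopGenerator γ →
      ∀ (Ω δ : ℂ) (Ωp : (unrIntegers 2)ˣ) (G : PowerSeries (PadicComplexInt 2)),
      Ω ≠ 0 → (δ ^ 2 = (NumberField.discr K : ℂ) ∨ δ ^ 2 = -(NumberField.discr K : ℂ)) →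
      IsKatzBranch ι v vbar S κ γ (HeckeCharacter.galConj c ψ)⁻¹ Ω δ ((Ωp : unrIntegers 2) : ℂ_[2]) G →
      ∀ (P : W.toAffine.Point) (c₀ : ℕ) (ℓ : ℤ),
      ¬ IsOfFinAddOrder P →
      (∀ R : W.toAffine.Point, ∃ (k : ℤ) (T : W.toAffine.Point), IsOfFinAddOrder T ∧ R = k • P + T) →
      c₀ ≠ 0 → (W.baseChange ℚ_[2]).IsInReductionKernel (c₀ • W.toPadicPoint 2 P) →
      ‖(W.baseChange ℚ_[2]).padicLogPoint (c₀ • W.toPadicPoint 2 P) / (c₀ : ℚ_[2])‖ = (2 : ℝ) ^ (-ℓ) →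
      ∃ m : ℤ, ‖((PowerSeries.constantCoeff G : PadicComplexInt 2) : ℂ_[2])‖ = (2 : ℝ) ^ (-(m : ℝ) / 2) ∧
      m = 2 * ((padicValNat 2 (Nat.card (AddCommGroup.primaryComponent W.sha 2)) : ℤ)
      + (padicValNat 2 W.tamagawaProduct : ℤ)
      - 2 * (padicValNat 2 W.torsionOrder : ℤ) + 2 * ℓ) + eB (d % 2) ((d / (2 - d % 2)) % 8))
    (hCST : thm11_ringClassChar) (h12 : thm12_fullBSD_twist) (h44 : thm44_ord_two_LAlg) (h14 : thm14_rankOne_twist)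
    (hGZ : ∀ (N : ℕ) [NeZero N] (W : WeierstrassCurve ℚ) (K : Type) [Field K] [NumberField K], gross_zagier N W K)
    (hKo : ∀ (N : ℕ) [NeZero N] (W : WeierstrassCurve ℚ) (K : Type) [Field K] [NumberField K], kolyvagin N W K)
    (hM : OptimalCurveManinCertificate cm7)
    (hEta : x049_x_sub_two_eq_etaQuotient) (hD : deuring_etaQuotient49_heegner_generates_conjPrime) :
    SplitBadTwoUpperHalfOfFacts := by
  intro hB W _ _ hCM hr hsplit hng
  exact PrintCf2.RubinValueTwo.splitBadTwoUpperHalfOfFacts_of_laws ⟨h0.1, h0.2.1, h0.2.2.1, h0.2.2.2.1⟩ (h2 h0.2.2.2.2 hB.1) h3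
    (stub_anchor_two_kit_of_thirteen hCST h12 h44 h14 h0.2.2.1 h0.2.2.2.1 hM hB.2.2.2.1 hGZ hKo hB.1 hEta hD)
    hB W hCM hr hsplit hng

/-- **The LOWER half (stmt-BirchSwinnertonDyer-27851) BY NAME from S0′ ∧ S2′ ∧ S3 ∧ nine prints** (p637992 `…LowerHalf…_of_laws` with the anchor
binder discharged by `stub_anchor_two_kit_of_thirteen`). CONDITIONAL on the displayed binders. [cite: Rubin1992, Cor. 10.3 (shape)] [cite: Miller2011LMS, Def. 1.1] -/
theorem splitBadTwoLowerHalfOfFacts_of_laws_of_prints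
    (h0 : DeShalit1987.thmII414_exists_katzBranch ∧ Deuring_exists_heckeCharacter_of_maximalCM ∧
      bsdTriple_of_rank_le_one_of_conductor_lt ∧ ModularForms.exists_isNewformOf ∧ GrossZagier1986_thm_I_7_3)
    (h2 : GrossZagier1986_thm_I_7_3 → rank_eq_analyticRank_of_analyticRank_le_one →
      ∃ eA : ℤ → ℤ → ℤ,
      ∀ (d : ℤ), d ≠ 0 → Squarefree d → d % 4 ≠ 1 →
      ∀ (W : WeierstrassCurve ℚ) [W.IsElliptic] [W.IsGloballyMinimal] (C : VariableChange ℚ),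
      C • W = cm7.quadraticTwist (d : ℚ) → W.analyticRank = 1 →
      ∀ (K : Type) [Field K] [NumberField K], IsImaginaryQuadratic K →
      ∀ (v vbar : HeightOneSpectrum (𝓞 K)),
      ((2 : ℕ) : 𝓞 K) ∈ v.asIdeal → ((2 : ℕ) : 𝓞 K) ∈ vbar.asIdeal → vbar ≠ v →
      ∀ (ι : PadicAlgCl 2 ≃+* ℂ),
      (∀ (w : InfinitePlace K) (k : 𝓞 K), k ∈ v.asIdeal ↔ ‖ι.symm (w.embedding (k : K))‖ < 1) →
      ∀ (c : K ≃ₐ[ℚ] K), c ≠ 1 →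
      ∀ (ψ : HeckeCharacter K), ψ.HasInfinityType (fun _ ↦ 1) (fun _ ↦ 0) →
      (∀ s : ℂ, 3 / 2 < s.re → heckeLFunction ψ s = W.LSeries s) →
      ∀ (S : Finset (HeightOneSpectrum (𝓞 K))),
      (∀ w : HeightOneSpectrum (𝓞 K), w ∈ S ↔ (¬ ψ.IsUnramifiedAt w ∧ w ≠ v ∧ w ≠ vbar)) →
      ∀ (κ : ZpExtension K 2) (γ : absoluteGaloisGroup K), κ.IsAnticyclotomic → κ.IsTopGenerator γ →
      ∀ (Ω δ : ℂ) (Ωp : (unrIntegers 2)ˣ) (G : PowerSeries (PadicComplexInt 2)),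
      Ω ≠ 0 → (δ ^ 2 = (NumberField.discr K : ℂ) ∨ δ ^ 2 = -(NumberField.discr K : ℂ)) →
      IsKatzBranch ι v vbar S κ γ (HeckeCharacter.galConj c ψ)⁻¹ Ω δ ((Ωp : unrIntegers 2) : ℂ_[2]) G →
      ∀ (P : W.toAffine.Point) (c₀ : ℕ) (ℓ : ℤ),
      ¬ IsOfFinAddOrder P →
      (∀ R : W.toAffine.Point, ∃ (k : ℤ) (T : W.toAffine.Point), IsOfFinAddOrder T ∧ R = k • P + T) →
      c₀ ≠ 0 → (W.baseChange ℚ_[2]).IsInReductionKernel (c₀ • W.toPadicPoint 2 P) →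
      ‖(W.baseChange ℚ_[2]).padicLogPoint (c₀ • W.toPadicPoint 2 P) / (c₀ : ℚ_[2])‖ = (2 : ℝ) ^ (-ℓ) →
      ∃ q : ℚ, shaAn W = (q : ℂ) ∧
      ∀ m : ℤ, ‖((PowerSeries.constantCoeff G : PadicComplexInt 2) : ℂ_[2])‖ = (2 : ℝ) ^ (-(m : ℝ) / 2) →
      m = 2 * (padicValRat 2 q + (padicValNat 2 W.tamagawaProduct : ℤ)
      - 2 * (padicValNat 2 W.torsionOrder : ℤ) + 2 * ℓ) + eA (d % 2) ((d / (2 - d % 2)) % 8))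
    (h3 : ∃ eB : ℤ → ℤ → ℤ,
      ∀ (d : ℤ), d ≠ 0 → Squarefree d → d % 4 ≠ 1 →
      ∀ (W : WeierstrassCurve ℚ) [W.IsElliptic] [W.IsGloballyMinimal] (C : VariableChange ℚ),
      C • W = cm7.quadraticTwist (d : ℚ) → W.analyticRank = 1 →
      ∀ (K : Type) [Field K] [NumberField K], IsImaginaryQuadratic K →
      ∀ (v vbar : HeightOneSpectrum (𝓞 K)),
      ((2 : ℕ) : 𝓞 K) ∈ v.asIdeal → ((2 : ℕ) : 𝓞 K) ∈ vbar.asIdeal → vbar ≠ v →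
      ∀ (ι : PadicAlgCl 2 ≃+* ℂ),
      (∀ (w : InfinitePlace K) (k : 𝓞 K), k ∈ v.asIdeal ↔ ‖ι.symm (w.embedding (k : K))‖ < 1) →
      ∀ (c : K ≃ₐ[ℚ] K), c ≠ 1 →
      ∀ (ψ : HeckeCharacter K), ψ.HasInfinityType (fun _ ↦ 1) (fun _ ↦ 0) →
      (∀ s : ℂ, 3 / 2 < s.re → heckeLFunction ψ s = W.LSeries s) →
      ∀ (S : Finset (HeightOneSpectrum (𝓞 K))),
      (∀ w : HeightOneSpectrum (𝓞 K), w ∈ S ↔ (¬ ψ.IsUnramifiedAt w ∧ w ≠ v ∧ w ≠ vbar)) →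
      ∀ (κ : ZpExtension K 2) (γ : absoluteGaloisGroup K), κ.IsAnticyclotomic → κ.IsTopGenerator γ →
      ∀ (Ω δ : ℂ) (Ωp : (unrIntegers 2)ˣ) (G : PowerSeries (PadicComplexInt 2)),
      Ω ≠ 0 → (δ ^ 2 = (NumberField.discr K : ℂ) ∨ δ ^ 2 = -(NumberField.discr K : ℂ)) →
      IsKatzBranch ι v vbar S κ γ (HeckeCharacter.galConj c ψ)⁻¹ Ω δ ((Ωp : unrIntegers 2) : ℂ_[2]) G →
      ∀ (P : W.toAffine.Point) (c₀ : ℕ) (ℓ : ℤ),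
      ¬ IsOfFinAddOrder P →
      (∀ R : W.toAffine.Point, ∃ (k : ℤ) (T : W.toAffine.Point), IsOfFinAddOrder T ∧ R = k • P + T) →
      c₀ ≠ 0 → (W.baseChange ℚ_[2]).IsInReductionKernel (c₀ • W.toPadicPoint 2 P) →
      ‖(W.baseChange ℚ_[2]).padicLogPoint (c₀ • W.toPadicPoint 2 P) / (c₀ : ℚ_[2])‖ = (2 : ℝ) ^ (-ℓ) →
      ∃ m : ℤ, ‖((PowerSeries.constantCoeff G : PadicComplexInt 2) : ℂ_[2])‖ = (2 : ℝ) ^ (-(m : ℝ) / 2) ∧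
      m = 2 * ((padicValNat 2 (Nat.card (AddCommGroup.primaryComponent W.sha 2)) : ℤ)
      + (padicValNat 2 W.tamagawaProduct : ℤ)
      - 2 * (padicValNat 2 W.torsionOrder : ℤ) + 2 * ℓ) + eB (d % 2) ((d / (2 - d % 2)) % 8))
    (hCST : thm11_ringClassChar) (h12 : thm12_fullBSD_twist) (h44 : thm44_ord_two_LAlg) (h14 : thm14_rankOne_twist)
    (hGZ : ∀ (N : ℕ) [NeZero N] (W : WeierstrassCurve ℚ) (K : Type) [Field K] [NumberField K], gross_zagier N W K)
    (hKo : ∀ (N : ℕ) [NeZero N] (W : WeierstrassCurve ℚ) (K : Type) [Field K] [NumberField K], kolyvagin N W K)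
    (hM : OptimalCurveManinCertificate cm7)
    (hEta : x049_x_sub_two_eq_etaQuotient) (hD : deuring_etaQuotient49_heegner_generates_conjPrime) :
    SplitBadTwoLowerHalfOfFacts := by
  intro hB W _ _ hCM hr hsplit hng
  exact PrintCf2.RubinValueTwo.splitBadTwoLowerHalfOfFacts_of_laws ⟨h0.1, h0.2.1, h0.2.2.1, h0.2.2.2.1⟩ (h2 h0.2.2.2.2 hB.1) h3
    (stub_anchor_two_kit_of_thirteen hCST h12 h44 h14 h0.2.2.1 h0.2.2.2.1 hM hB.2.2.2.1 hGZ hKo hB.1 hEta hD)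
    hB W hCM hr hsplit hng

/-! ## §2 The defect-key socket without a kit anchor: (DK) ∧ prints ⟹ the crux -/

/-- **LEAD g9's ROAD-NEUTRAL SOCKET WITHOUT A KIT ANCHOR — the crux BY NAME from (DK) and PRINTS ONLY.** `hdef` = the facts-relative defect-key
statement (DK) of `PrintCf2SplitBadTwoDefectKeyAtTwo` verbatim («ONE function `e` of the 2-adic key with `ord₂ #Ш_an(W) = ord₂ #Ш(W)[2^∞] + e(key)`
for every analytic-rank-one minimal model of `49a1^{(d)}`, `d ≢ 1 (mod 4)`»); prints: `hS31` (Creutz–Miller), `hnew` (Modularity), `hGZ73` (Gross–Zagier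
I.(7.3)) and the nine bsd-goldfeld binders behind the anchors (`hGZK`, `hBF` from `𝔅_split`). Proof = `splitBadTwoRankOneOfFacts_of_defectKey` with `h4 :=
stub_anchor_two_kit_of_thirteen …`. So, modulo prints, the research content of the whole class is EXACTLY (DK) — no anchor certificate, no kit.
CONDITIONAL on the displayed binders. [cite: Miller2011LMS, Def. 1.1] [cite: CreutzMiller2012, Thm. 1.1] [cite: CoatesLiTianZhai2015, Thm. 1.2 (p. 359) and Thm. 1.4] -/
theorem splitBadTwoRankOneOfFacts_of_defectKey_of_prints
    (hS31 : bsdTriple_of_rank_le_one_of_conductor_lt) (hnew : ModularForms.exists_isNewformOf)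
    (hGZ73 : GrossZagier1986_thm_I_7_3)
    (hdef : GrossZagier1986_thm_I_7_3 → rank_eq_analyticRank_of_analyticRank_le_one →
      ∃ e : ℤ → ℤ → ℤ,
      ∀ (d : ℤ), d ≠ 0 → Squarefree d → d % 4 ≠ 1 →
      ∀ (W : WeierstrassCurve ℚ) [W.IsElliptic] [W.IsGloballyMinimal] (C : VariableChange ℚ),
        C • W = cm7.quadraticTwist (d : ℚ) → W.analyticRank = 1 →
      ∃ q : ℚ, shaAn W = (q : ℂ) ∧
        padicValRat 2 q = (padicValNat 2 (Nat.card (AddCommGroup.primaryComponent W.sha 2)) : ℤ)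
          + e (d % 2) ((d / (2 - d % 2)) % 8))
    (hCST : thm11_ringClassChar) (h12 : thm12_fullBSD_twist) (h44 : thm44_ord_two_LAlg) (h14 : thm14_rankOne_twist)
    (hGZ : ∀ (N : ℕ) [NeZero N] (W : WeierstrassCurve ℚ) (K : Type) [Field K] [NumberField K], gross_zagier N W K)
    (hKo : ∀ (N : ℕ) [NeZero N] (W : WeierstrassCurve ℚ) (K : Type) [Field K] [NumberField K], kolyvagin N W K)
    (hM : OptimalCurveManinCertificate cm7)
    (hEta : x049_x_sub_two_eq_etaQuotient) (hD : deuring_etaQuotient49_heegner_generates_conjPrime) :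
    SplitBadTwoRankOneOfFacts := by
  intro hB W _ _ hCM hr hsplit hng
  exact PrintCf2.RubinValueTwo.splitBadTwoRankOneOfFacts_of_defectKey hS31 hnew hGZ73 hdef
    (stub_anchor_two_kit_of_thirteen hCST h12 h44 h14 hS31 hnew hM hB.2.2.2.1 hGZ hKo hB.1 hEta hD)
    hB W hCM hr hsplit hng

end Summit.BirchSwinnertonDyer.BirchSwinnertonDyer.Theorems.PrintCf2.RubinValueTwoAnchor

end
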